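import Literature.MathematicalPhysics.QuantumLattice.HubbardKuboKishiFSum
import Literature.MathematicalPhysics.QuantumLattice.HubbardKuboKishiGaussianDomination
import HarnessLib

/-!
# Kubo–Kishi 1990, Theorem 1 at `q = 0`: the zero-field spin susceptibility of the attractive
# Hubbard model is at most `(4|U|)⁻¹` per site, at every temperature and filling, in every dimension

Topic `MathematicalPhysics/QuantumLattice` (family `hubbard`); companion of
`HubbardHalfFilledCompressibilityBound.lean` (the charge twin at half filling). K. Kubo, T. Kishi,
*Rigorous bounds on the susceptibilities of the Hubbard model*, Phys. Rev. B **41** (1990) 4866–4868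
[KuboKishi1990] (reprinted in A. Montorsi (ed.), *The Hubbard Model*, World Scientific 1992; read
there, reprint pp. 120–124 = PRB pp. 4866–4867).

Kubo–Kishi's Theorem 1: "Assume `U` is negative and `μ_{ασ} = μ_α` (no external magnetic field). …
Then we can bound the spin susceptibility as `χ_q ≤ (4|U|)⁻¹`" (eq. (3)), `χ_q = β(S^z_q, S^z_{-q})`
the Duhamel two-point function (eq. (2)), at EVERY wave vector; abstract: "In the attractive model
the spin susceptibility is bounded above by `(4|U|)⁻¹`". At `q = 0`, `S^z_0 = |Λ|^{-1/2} S^z_tot`, this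
is `β (S^z_tot, S^z_tot)_Duh ≤ |Λ|/(4|U|)`; by the linear-response (susceptibility) formula
`∂_h Re ⟨S^z_tot⟩_{β, K - h S^z_tot} = β [Re (S^z_tot, S^z_tot)_Duh - (Re ⟨S^z_tot⟩)²]` (Bratteli–Robinson
II §5.4.1; tree `hasDerivAt_re_gibbsState_source`) the zero-field uniform spin susceptibility — the
`h`-derivative of the magnetisation of the grand-canonical state of `H(t,U) - μN - h S^z_tot` at
`h = 0` — is therefore at most `|Λ|/(4|U|)`:

* `hubbard_hasDerivAt_re_gibbsState_spinZ` — the susceptibility formula for `A = S^z_tot`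
  (`HubbardWave0.spinZ = ½ Σ_x (n_{x↑} - n_{x↓})`), any `t, U, μ`, field `h₀`;
* `duhamel_spinZ_eq_quarter_spinDensityField` — `(S^z_tot, S^z_tot)_Duh = ¼ (M_1, M_1)_Duh` with
  `M_1 = Σ_x (n_{x↑} - n_{x↓})` Kubo–Kishi's spin field at `a ≡ 1` (`spinDensityField 1 = 2 S^z_tot`);
* **`hubbard_attractive_spinSusceptibility_le`** — for every finite graph, every `t`, every `μ`
  (any filling), every `U < 0` and every `0 < β < ∞`:
  `0 ≤ ∂_h Re ⟨S^z_tot⟩_{β, H(t,U) - μN - h S^z_tot} |_{h = 0} ≤ |Λ| / (4|U|)`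
  (Kubo–Kishi (10)/(3) at `q = 0`: `kuboKishi_spin_duhamel_le` with `a ≡ 1`, from the PROVED Gaussian
  domination `kuboKishi_spin_gaussianDomination_holds`; the lower bound is positivity of the Duhamel
  variance, `(A - ⟨A⟩, A - ⟨A⟩)_Duh ≥ 0`);
* `hubbardTorus_attractive_spinSusceptibility_le` — the same on the torus `(ℤ/Lℤ)^d`: `≤ L^d/(4|U|)`.

Scope (honest): derivative at ZERO field only (Kubo–Kishi's hypothesis `μ_{α↑} = μ_{α↓}`), longitudinal
(`S^z`) response, `U < 0`, finite lattices (bound uniform per site), `β > 0`; nothing on the repulsive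
model. Theorems only; no definition, no named fact, no statement of the tree is changed.
HONEST FRAMING (cell pub-hubbard): ladder R1–R4 with certified numbers; no claim on H/H₀.

References: [KuboKishi1990] Theorem 1, eqs. (2), (3), (10), abstract (PRB 41, pp. 4866–4867);
O. Bratteli, D. W. Robinson, *Operator Algebras and QSM 2* (1997) §5.4.1 [BratteliRobinsonII1997];
[DLS1978] eq. (5), Thm 3.1 (`(A,A) ≥ 0`).
-/

noncomputable section

namespace Literature.MathematicalPhysics.QuantumLattice

open Matrix Finset HubbardWave0
open scoped ComplexOrder

section General

variable {Λ : Type} [LinearOrder Λ] [Fintype Λ] (G : SimpleGraph Λ) [DecidableRel G.Adj]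

omit [DecidableRel G.Adj] in
/-- `S^z_tot = ½ M_1`, `M_1 = Σ_x (n_{x↑} - n_{x↓})` Kubo–Kishi's spin field with the uniform test
function. Kubo–Kishi (1990), eqs. (2), (7). [cite: KuboKishi1990, eqs. (2), (7)] -/
theorem spinZ_eq_half_smul_spinDensityField_one :
    (HubbardWave0.spinZ : Matrix (Finset (Orb Λ)) (Finset (Orb Λ)) ℂ) =
      (1 / 2 : ℂ) • spinDensityField fun _ : Λ => (1 : ℝ) := by
  unfold HubbardWave0.spinZ spinDensityField
  simp only [Complex.ofReal_one, one_smul]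

omit [DecidableRel G.Adj] in
/-- `S^z_tot` is Hermitian (plumbing). [folklore] -/
private theorem isHermitian_spinZ' :
    (HubbardWave0.spinZ : Matrix (Finset (Orb Λ)) (Finset (Orb Λ)) ℂ).IsHermitian := by
  rw [spinZ_eq_half_smul_spinDensityField_one]
  have h := isHermitian_real_smul (isHermitian_spinDensityField fun _ : Λ => (1 : ℝ)) (1 / 2)
  convert h using 2
  push_cast
  ring

omit [DecidableRel G.Adj] in
/-- Homogeneity of the Duhamel function in both slots: `(cA, cB)_Duh = c² (A, B)_Duh` (plumbing).
[folklore] -/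
private theorem duhamel_smul_smul' {n : Type*} [Fintype n] [DecidableEq n] (β : ℝ)
    (H A B : Matrix n n ℂ) (c : ℂ) :
    duhamel β H (c • A) (c • B) = c * c * duhamel β H A B := by
  unfold duhamel
  rw [mul_left_comm, ← smul_eq_mul (c * c), ← intervalIntegral.integral_smul]
  congr 1
  refine intervalIntegral.integral_congr fun s _ => ?_
  simp only [Matrix.smul_mul, Matrix.mul_smul, trace_smul, smul_eq_mul]
  ring

omit [DecidableRel G.Adj] in
/-- `(S^z_tot, S^z_tot)_Duh = ¼ (M_1, M_1)_Duh`. Kubo–Kishi (1990), eq. (10) with `h_α ≡ const`.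
[cite: KuboKishi1990, eq. (10)] -/
theorem duhamel_spinZ_eq_quarter_spinDensityField (β : ℝ)
    (K : Matrix (Finset (Orb Λ)) (Finset (Orb Λ)) ℂ) :
    duhamel β K HubbardWave0.spinZ HubbardWave0.spinZ =
      (1 / 4 : ℂ) * duhamel β K (spinDensityField fun _ : Λ => (1 : ℝ))
        (spinDensityField fun _ : Λ => (1 : ℝ)) := by
  rw [spinZ_eq_half_smul_spinDensityField_one, duhamel_smul_smul']
  norm_num

/-- **The susceptibility formula for the magnetisation**: for every field `h₀` and all `t, U, μ`,
`β > 0`, `h ↦ Re ⟨S^z_tot⟩_{β, H(t,U) - μN - h S^z_tot}` is differentiable at `h₀` with derivative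
`β [Re (S^z_tot, S^z_tot)_{Duh; h₀} - (Re ⟨S^z_tot⟩_{h₀})²]` (tree `hasDerivAt_re_gibbsState_source`,
source `A = S^z_tot`). Bratteli–Robinson II §5.4.1; Kubo–Kishi (1990), eq. (2).
[cite: BratteliRobinsonII1997, §5.4.1] [cite: KuboKishi1990, eq. (2)] -/
theorem hubbard_hasDerivAt_re_gibbsState_spinZ [Nonempty Λ] (t U μ : ℝ) {β : ℝ} (hβ : 0 < β)
    (h₀ : ℝ) :
    HasDerivAt (fun h : ℝ =>
        (gibbsState β (hamiltonianWith G t U μ - (h : ℂ) • HubbardWave0.spinZ) HubbardWave0.spinZ).re)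
      (β * ((duhamel β (hamiltonianWith G t U μ - (h₀ : ℂ) • HubbardWave0.spinZ)
          HubbardWave0.spinZ HubbardWave0.spinZ).re -
        (gibbsState β (hamiltonianWith G t U μ - (h₀ : ℂ) • HubbardWave0.spinZ)
          HubbardWave0.spinZ).re ^ 2)) h₀ :=
  hasDerivAt_re_gibbsState_source (isHermitian_hamiltonianWith G t U μ) isHermitian_spinZ' hβ h₀

omit [DecidableRel G.Adj] in
/-- The Duhamel variance is nonnegative: `(Re ⟨A⟩)² ≤ Re (A, A)_Duh` for Hermitian `K`, `A`
(`(A - c, A - c)_Duh ≥ 0` with `c = Re ⟨A⟩`, expanded by `duhamel_sub_smul_one`).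
[cite: DLS1978, Thm. 3.1] -/
theorem re_gibbsState_sq_le_re_duhamel_self [Nonempty Λ] (β : ℝ)
    {K A : Matrix (Finset (Orb Λ)) (Finset (Orb Λ)) ℂ} (hK : K.IsHermitian) (hA : A.IsHermitian) :
    (gibbsState β K A).re ^ 2 ≤ (duhamel β K A A).re := by
  set c : ℝ := (gibbsState β K A).re with hc
  have h0 := hK.re_duhamel_self_nonneg (isHermitian_sub_smul hA isHermitian_one c) β
  rw [duhamel_sub_smul_one hK β A (c : ℂ)] at h0
  have hre : (duhamel β K A A - 2 * (c : ℂ) * gibbsState β K A + (c : ℂ) ^ 2).re =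
      (duhamel β K A A).re - 2 * c * (gibbsState β K A).re + c ^ 2 := by
    simp only [Complex.sub_re, Complex.add_re]
    have h2 : ((2 : ℂ) * (c : ℂ) * gibbsState β K A).re = 2 * c * (gibbsState β K A).re := by
      rw [show (2 : ℂ) * (c : ℂ) = ((2 * c : ℝ) : ℂ) by push_cast; ring, Complex.re_ofReal_mul]
    have hsq : ((c : ℂ) ^ 2).re = c ^ 2 := by norm_cast
    rw [h2, hsq]
  rw [hre, ← hc] at h0
  nlinarith

/-- **Kubo–Kishi 1990, Theorem 1 at `q = 0`: the zero-field spin susceptibility of the attractive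
Hubbard model is at most `(4|U|)⁻¹` per site.** For every finite graph, every hopping `t`, every
chemical potential `μ`, every `U < 0` and every `0 < β < ∞`, the magnetisation of the grand-canonical
Gibbs state of `H(t,U) - μN - h S^z_tot` satisfies
`0 ≤ ∂_h Re ⟨S^z_tot⟩ |_{h = 0} ≤ |Λ| / (4|U|)`: the derivative is the Duhamel variance
`β [Re (S^z, S^z) - (Re ⟨S^z⟩)²] ≤ β Re (S^z, S^z) = ¼ β Re (M_1, M_1) ≤ ¼ β · |Λ|/(β|U|)`
(`kuboKishi_spin_duhamel_le`, `a ≡ 1`, Gaussian domination `kuboKishi_spin_gaussianDomination_holds`).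
"In the attractive model the spin susceptibility is bounded above by `(4|U|)⁻¹` where `U (< 0)` is
the on-site interaction potential." [cite: KuboKishi1990, Theorem 1, eq. (3) (q = 0), abstract (PRB 41, p. 4866)]
[cite: BratteliRobinsonII1997, §5.4.1] -/
theorem hubbard_attractive_spinSusceptibility_le [Nonempty Λ] (t μ : ℝ) {U β : ℝ} (hU : U < 0)
    (hβ : 0 < β) :
    0 ≤ deriv (fun h : ℝ =>
        (gibbsState β (hamiltonianWith G t U μ - (h : ℂ) • HubbardWave0.spinZ)
          HubbardWave0.spinZ).re) 0 ∧
    deriv (fun h : ℝ =>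
        (gibbsState β (hamiltonianWith G t U μ - (h : ℂ) • HubbardWave0.spinZ)
          HubbardWave0.spinZ).re) 0 ≤ (Fintype.card Λ : ℝ) / (4 * |U|) := by
  rw [(hubbard_hasDerivAt_re_gibbsState_spinZ G t U μ hβ 0).deriv]
  simp only [Complex.ofReal_zero, zero_smul, sub_zero]
  have hH := isHermitian_hamiltonianWith G t U μ
  have hvar := re_gibbsState_sq_le_re_duhamel_self (Λ := Λ) β hH isHermitian_spinZ'
  have hKK := kuboKishi_spin_duhamel_le G kuboKishi_spin_gaussianDomination_holds (t := t) (μ := μ)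
    hU hβ fun _ : Λ => (1 : ℝ)
  simp only [one_pow, Finset.sum_const, Finset.card_univ, nsmul_eq_mul, mul_one] at hKK
  have hq : (duhamel β (hamiltonianWith G t U μ) HubbardWave0.spinZ HubbardWave0.spinZ).re =
      1 / 4 * (duhamel β (hamiltonianWith G t U μ) (spinDensityField fun _ : Λ => (1 : ℝ))
        (spinDensityField fun _ : Λ => (1 : ℝ))).re := by
    rw [duhamel_spinZ_eq_quarter_spinDensityField]
    rw [show (1 / 4 : ℂ) = ((1 / 4 : ℝ) : ℂ) by push_cast; ring, Complex.re_ofReal_mul]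
  have hU0 : 0 < |U| := abs_pos.2 hU.ne
  refine ⟨mul_nonneg hβ.le (by linarith), ?_⟩
  calc β * ((duhamel β (hamiltonianWith G t U μ) HubbardWave0.spinZ HubbardWave0.spinZ).re -
          (gibbsState β (hamiltonianWith G t U μ) HubbardWave0.spinZ).re ^ 2)
      ≤ β * (1 / 4 * ((Fintype.card Λ : ℝ) / |U| / β)) := by
        refine mul_le_mul_of_nonneg_left ?_ hβ.le
        rw [hq] at hvar ⊢
        nlinarith [sq_nonneg ((gibbsState β (hamiltonianWith G t U μ) HubbardWave0.spinZ).re)]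
    _ = (Fintype.card Λ : ℝ) / (4 * |U|) := by field_simp

end General

/-! ### The torus `(ℤ/Lℤ)^d` -/

section Torus

variable {d L : ℕ}

/-- The fermionic torus has `L^d` sites (private copy). [folklore] -/
private theorem card_fermionTorus_s : Fintype.card (FermionTorus d L) = L ^ d := by
  change Fintype.card (Fin d → Fin L) = L ^ d
  rw [Fintype.card_fun, Fintype.card_fin, Fintype.card_fin]

/-- **Zero-field spin susceptibility of the attractive Hubbard torus, every dimension and filling**:
for `L ≥ 1`, every `d`, `t`, `μ`, `U < 0`, `0 < β < ∞`,
`0 ≤ ∂_h Re ⟨S^z_tot⟩_{β, hubbardTorusWith d L t U μ - h S^z_tot} |_{h = 0} ≤ L^d / (4|U|)`.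
[cite: KuboKishi1990, Theorem 1, eq. (3) (q = 0)] -/
theorem hubbardTorus_attractive_spinSusceptibility_le [NeZero L] (t μ : ℝ) {U β : ℝ} (hU : U < 0)
    (hβ : 0 < β) :
    0 ≤ deriv (fun h : ℝ =>
        (gibbsState β (hubbardTorusWith d L t U μ - (h : ℂ) • HubbardWave0.spinZ)
          HubbardWave0.spinZ).re) 0 ∧
    deriv (fun h : ℝ =>
        (gibbsState β (hubbardTorusWith d L t U μ - (h : ℂ) • HubbardWave0.spinZ)
          HubbardWave0.spinZ).re) 0 ≤ (L : ℝ) ^ d / (4 * |U|) := by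
  haveI : Nonempty (FermionTorus d L) := ⟨toLex fun _ => ⟨0, Nat.pos_of_ne_zero (NeZero.ne L)⟩⟩
  have h := hubbard_attractive_spinSusceptibility_le (fermionTorusGraph d L) t μ hU hβ
  rw [card_fermionTorus_s, Nat.cast_pow] at h
  unfold hubbardTorusWith
  -- `convert`: structural versus order-derived `DecidableEq` instance on the orbitals
  convert h

end Torus

end Literature.MathematicalPhysics.QuantumLattice
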